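import Literature.AlgebraicGeometry.Frobenioids.GeometricFrobenioidThm62iFunctor
import HarnessLib

/-!
# Frobenioids I, Example 6.1 / Theorem 6.2: the interface `GeometricDivisorData` is INHABITED (vacuity guard)

Mochizuki, *The geometry of Frobenioids I: the general theory*, Kyushu J. Math. **62** (2008) 293–400, Ex. 6.1,
kurims p. 109 (the data `D_L`, `Φ(L) ⊆ ℤ_{≥0}[D_L]`, `B(L) ⊆ L^×`, `B(L) → Φ(L)^gp`, "`D_K` is `K̃`-`ℚ`-Cartier")
[cite: MochizukiFrdI2008, Ex. 6.1 p.109] and Thm. 6.2 p. 110 ("`D_K ≠ ∅`") [cite: MochizukiFrdI2008, Thm. 6.2 p.110].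

The cell types the geometric input of §6 as the INTERFACE `GeometricDivisorData K K̃` (abc-iut-L1-t3, v4 =
p413022 with the saturation field `sub_mem`) — 20 fields, no instance in the tree (proper normal varieties are
not in Mathlib).  Every theorem of the §6 chain (Thm. 6.2 (i)–(iv) at the models, the S3 / W5 sub-DAG rows) is
universally quantified over that interface, so its JOINT SATISFIABILITY is what keeps them from being vacuous
(audit note N1 of abc-iut-w5-d150 on p413022).  This file CERTIFIES it in the kernel with the smallest honest
inhabitant — the data of a proper normal curve with ONE chosen prime divisor that is totally ramified (ramification
index `1` is allowed by the interface) in every finite subextension and carries no nonconstant rational function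
with zeros/poles supported on it: `D_L = {pt}`, `Φ(L) = ℤ_{≥0}·pt` (all effective multiples: saturated, `ℚ`-Cartier
with `n = 1`), `B(L) = 1`, `div = 0`, primes below = identity, `e = 1` — and records the consequences:
`GeometricDivisorData.trivial`, `nonempty_geometricDivisorData`, and (so that the W5 functoriality rows are
visibly non-vacuous too) a pull-back datum over the identity base functor between two copies of it
(`GeometricDivisorData.trivialPullbackDatum`, = the Frobenius datum at `p = 1`) with abc-iut-L1-t3's schema
`Thm62i` holding there (`thm62i_trivial`).  CONSTRUCTIONS + theorems only; no `Prop`-valued named fact; nothing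
here bears on [IUTchIII] or abc.
-/

noncomputable section

namespace Literature.AlgebraicGeometry.Frobenioids

open CategoryTheory

namespace GeometricDivisorData

variable (K : Type) [Field K] (Kt : Type) [Field Kt] [Algebra K Kt]

/-- **An inhabitant of the interface `GeometricDivisorData K K̃`** (vacuity guard for Ex. 6.1 / Thm. 6.2): one
prime divisor over every `Spec L`, `Φ(L) = ℤ_{≥0}[D_L]` (all effective divisors — saturated and `ℚ`-Cartier),
`B(L)` trivial with `div = 0`, primes below = identity, ramification indices `1`.
[cite: MochizukiFrdI2008, Ex. 6.1 p.109] -/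
def trivial : GeometricDivisorData K Kt where
  primeDiv _ := Unit
  Phi _ := ⊤
  B _ := ⊥
  div _ := 1
  over _ Q := Q
  ram _ _ := 1
  ram_pos _ _ := Nat.one_pos
  over_finite _ _ := Set.toFinite _
  over_surjective _ := fun Q => ⟨Q, rfl⟩
  over_id _ _ := rfl
  ram_id _ _ := rfl
  over_comp _ _ _ := rfl
  ram_comp _ _ _ := rfl
  pull_mem _ _ _ := AddSubmonoid.mem_top _
  map_mem σ f hf := by
    rw [Subgroup.mem_bot] at hf
    rw [hf, map_one]
    exact (⊥ : Subgroup _).one_mem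
  div_natural σ f := by
    rw [MonoidHom.one_apply, MonoidHom.one_apply, toAdd_one, map_zero]
  div_mem_gp X f := ⟨0, AddSubmonoid.mem_top _, 0, AddSubmonoid.mem_top _, by
    rw [MonoidHom.one_apply, toAdd_one, sub_self]⟩
  qCartier _ P := ⟨1, Nat.one_pos, AddSubmonoid.mem_top _⟩
  sub_mem _ _ _ _ _ _ := AddSubmonoid.mem_top _
  primeDiv_nonempty := ⟨⟨⊥⟩, ⟨()⟩⟩

/-- The interface `GeometricDivisorData K K̃` is inhabited for EVERY `K ⊆ K̃` — the universally quantified §6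
theorems over it are not vacuous. [cite: MochizukiFrdI2008, Ex. 6.1 p.109] -/
theorem nonempty_geometricDivisorData : Nonempty (GeometricDivisorData K Kt) := ⟨trivial K Kt⟩

/-- A pull-back datum between two copies of the inhabitant over the identity base functor (Thm. 6.2 (i)'s
"compatible natural transformations `Φ₁ → Φ₂|_{D₁}`, `B₁ → B₂|_{D₁}`" — here the identity ones; = the Frobenius
datum of abc-iut-w5-d048's `frobeniusPullbackDatum` at exponent `1`). [cite: MochizukiFrdI2008, Thm. 6.2 (i) p.111] -/
def trivialPullbackDatum : PullbackDatum (trivial K Kt) (trivial K Kt) (𝟭 (FinSubextCat K Kt)) :=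
  (trivial K Kt).frobeniusPullbackDatum 1

variable [IsGalois K Kt]

/-- … at which abc-iut-L1-t3's schema `Thm62i` HOLDS (instance of `PullbackDatum.thm62i_of_pullbackDatum`):
the W5 functoriality rows are non-vacuous. [cite: MochizukiFrdI2008, Thm. 6.2 (i) p.110] -/
theorem thm62i_trivial :
    Thm62i (geomModelFrobenioid (trivial K Kt)) (geomModelFrobenioid (trivial K Kt)) (𝟭 (FinSubextCat K Kt))
      (fun X => ((trivialPullbackDatum K Kt).η.app (Opposite.op X)).hom) :=
  (trivialPullbackDatum K Kt).thm62i_of_pullbackDatum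

end GeometricDivisorData

end Literature.AlgebraicGeometry.Frobenioids

end
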